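import Summits.NavierStokesRegularity.TurbBounds.LayerForm
import Summits.NavierStokesRegularity.TurbBounds.Certs.P2R0.Evaluator
import HarnessLib

/-!
# Row P2-R0 — the row-level theorem `Nu ≤ (3/16)·Ra^{1/2} − 1/2` for every `Ra ≥ 64`, from two named hypotheses
(cell `pub-turb` / `turb-bounds`; LEAN-MAP §1 `TurbBounds/Results/<Row>.lean`, §2 step 7; lead decision 70 (b); CERTIFIED.md row P2-R0 = the
soundness row of the Ra-uniform ladder, member `(s, κ, η′) = (3/2, 4, 1)`, container `HOME/pub-turb-sos/certs/P2-R0-soundness-linear-k4/cert.json`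
(rbcert-par/0, sha256 `97b1a358…`); proof of record HOME/pub-turb-sos/P2-PROOF.md §2 (= paper Appendix A.7). Written by pub-turb-sos,
planner-pub-turb-sos-g8-0.)

HONEST FRAMING: rigorous bounds for the stated PDE and boundary conditions; no claim about physical turbulence beyond the bound.

WHAT IS KERNEL-CHECKED BY THIS FILE together with its imports (all in the project tree; no `sorry`, no `native_decide`, axioms standard):
the complete chain `LayerReduction Nu → TailLemma → ∀ Ra ≥ 64, Nu Ra ≤ (3/16)·√Ra − 1/2`, namely
* the FINITE CERTIFICATE on the wavenumber continuum `0 < K ≤ K_c = 7/2`, consumed BY NAME: `Certs.P2R0.Evaluator.certificate` (for every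
  real `K` there, an element LMI `MelR ε (1/K) K ⪰ 0` of the literal 13 × 13 rule holds with both tail slacks `≥ 0` — seven exact PSD
  blocks, the 7 × 169 rule identities, Gram certificates of the pencil coefficients, the interval lemmas R-I / R-I′);
* the CUTOFF `K ≥ 7/2` in full: the tree's cutoff scalar `Certs.P2R0.Evaluator.cutoff` (`T² ≤ (s−1)·s·K_c²`, i.e. `9 ≤ 147/16`, BY NAME,
  transported to `ℝ`) and `|g| ≡ 3 ≤ T = 3` feed `LayerForm.layerPositivity_of_cover` / `layerForm_nonneg_of_cutoff` (pointwise
  nonnegativity via `TurbBounds.p2_cutoff_abs`), so the layer form is `≥ 0` for all test functions beyond the cutoff;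
* the cover of all `K > 0` and the member arithmetic `s·I₂/(2κ) = (3/2·1)/8 = 3/16`, `s − 1 = 1/2`, `Ra₀ = 4κ² = 64`, `∫₀¹ η′ = 1`, `I₂ = 1`.

THE TWO NAMED HYPOTHESES (harness model — a published theorem and refereed one-page lemmas, USED AS HYPOTHESES, not proved in this cell;
docstrings give the exact transcription with equation numbers for the referee's check):
* `LayerForm.LayerReduction Nu` (TurbBounds/LayerForm.lean): P2-PROOF 2.1–2.5 = Appendix A.1, A.2, A.7 (a)(b) — the affine background-method
  reduction [cite: DingKerswell2019, (13)–(16)] for the P2 profile with the bulk-drop / rescaling lemmas R-P2a/b;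
* `TailLemma` (below): P2-PROOF (2.7) = SPEC-P2 (1.6) at the data `(u, v) = (1/K, K)` — the Legendre tail lemma R-T (rbsdp SPEC 3.4–3.7;
  Appendix A.6, A.7 (d)) with R-P2d/e, FOR THE LITERAL RULE `Certs.P2R0.Evaluator.MelR` (`N = 4`, `P = 0`, `λ_W = 16/36465`, `λ_T = 4/165`).
  As ONE hypothesis over the tree's literal matrices it also covers LEAN-MAP's data item '(a) the eight piece matrices are the Legendre–Galerkin
  objects of rbsdp SPEC 3.3–3.6' (re-derived independently by generator B: gen_b A/B PIECEWISE EQUAL 7/7, HOME/tribunal/t2-verify.md) — were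
  they not, `TailLemma` would simply be false, and nothing here hides that.
What `Nu` denotes and why `∀ Nu` is the right quantifier: `LayerReduction`'s docstring (the Nusselt number of any fixed admissible solution;
no-slip isothermal plates, every Pr, every horizontal period, d = 2, 3).

VACUITY GUARDS (lead decision 70 (b)(3)), kernel-checked: `tailLemma_antecedent_witness` (the antecedent of `TailLemma` is met, e.g. at `K = 1`,
so it is not vacuously true), `LayerForm.layerReduction_conduction` (`LayerReduction (fun _ => 1)` holds: satisfiable), `layerReduction_nontrivial`
(`TailLemma → ¬ LayerReduction (fun _ => 2)`: not trivially true for every `Nu`). Integrals are interval integrals of continuous integrands on the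
test class (`V ∈ C²`, `Θ ∈ C¹`, `η′` continuous), so no Bochner junk value is involved in the intended instances.

NOT CLAIMED: a formal proof of the Navier–Stokes/Boussinesq reduction or of the tail lemma (refereed prose + citation, exactly as in the paper's
§3 'trust base'); nothing about physical turbulence.
-/

set_option linter.style.longLine false

noncomputable section

namespace Summit.NavierStokesRegularity.TurbBounds.Results.P2R0

open MeasureTheory intervalIntegral Summit.NavierStokesRegularity.TurbBounds.LayerForm

/-! ## 1. The named tail hypothesis for the literal P2-R0 rule -/

/-- **Named hypothesis `TailLemma`** (R-T + R-P2d/e for the literal P2-R0 element rule; refereed, NOT proved here; lead decision 70 (b)(1)).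
TRANSCRIPTION of P2-PROOF (2.7) = SPEC-P2 (1.6) at the block data `(u, v) = (1/K, K)` (where the relaxed form `G(1/K, K)` IS `2Q̃_K`):
for every real wavenumber datum `K > 0` and every rational Young weight `ε > 0` — IF the 13 × 13 element matrix `M_el(ε; 1/K, K)`
(the tree's `Certs.P2R0.Evaluator.MelR ε (1/K) K` = `(s−1)·PW(u,v) + s·PT(v) + ĝ₀·CE₀ + T·CT(ε)` with the P2-R0 data `s = 3/2`, `ĝ₀ = −3`,
`T = 3`, `N = 4`, `P = 0`) is positive semidefinite, AND the two tail slacks `c_W = 16·(1/K)·(s−1) − T·ε·λ_W ≥ 0`, `c_T = 4s − T·λ_T/ε ≥ 0` hold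
(`λ_W = 16/36465`, `λ_T = 4/165`; literally the conjuncts of `Certs.P2R0.Evaluator.certificate`) — THEN the rescaled layer form SPEC-P2 (1.1) of
the member `(3/2, 4, η′ ≡ 1)` is nonnegative on the one-sided class: `0 ≤ layerForm (3/2) 4 1 K V Θ` for all `V ∈ C²`, `Θ ∈ C¹` with
`V(−1) = V′(−1) = Θ(−1) = 0`. SOURCE of the content: Legendre expansion of `(V″, Θ′)`, the integration ladders using the conditions at `x = −1`
only, the exact finite coupling part, and ε-weighted Young bounds of the two tail couplings with `λ_W = λ(5,6)·λ(6,7)`, `λ_T = λ(5,6)`,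
`λ(J, J+1) = 4/((2J+1)(2J+5))` — rbsdp SPEC 3.3–3.7 (paper Appendix A.6, A.7 (d); after [cite: DingKerswell2019, (13)–(16)]'s setting);
HOME/tribunal/t-lemmas.md passes 1–3 (R-T, R-P2d, R-P2e PASS). -/
def TailLemma : Prop :=
  ∀ K : ℝ, 0 < K → ∀ ε : ℚ, 0 < ε →
    (Certs.P2R0.Evaluator.MelR ε (1 / K) K).PosSemidef →
    0 ≤ 16 * (1 / K) * ((Certs.P2R0.Evaluator.s : ℝ) - 1)
          - (Certs.P2R0.Evaluator.T : ℝ) * (ε : ℝ) * (Certs.P2R0.Evaluator.lamW : ℝ) →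
    0 ≤ 4 * Certs.P2R0.Evaluator.s - Certs.P2R0.Evaluator.T * Certs.P2R0.Evaluator.lamT / ε →
    ∀ V Θ : ℝ → ℝ, OneSided V Θ → 0 ≤ layerForm (3 / 2) 4 (fun _ => 1) K V Θ

/-- Vacuity guard (i): the antecedent of `TailLemma` is met — at `K = 1` the tree's certificate supplies a weight `ε > 0` with the LMI and
both slacks (so `TailLemma` is an implication with a realisable premise on the whole continuum, not a vacuous truth). -/
theorem tailLemma_antecedent_witness :
    ∃ ε : ℚ, 0 < ε ∧ (Certs.P2R0.Evaluator.MelR ε (1 / (1 : ℝ)) (1 : ℝ)).PosSemidef ∧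
      0 ≤ 16 * (1 / (1 : ℝ)) * ((Certs.P2R0.Evaluator.s : ℝ) - 1)
            - (Certs.P2R0.Evaluator.T : ℝ) * (ε : ℝ) * (Certs.P2R0.Evaluator.lamW : ℝ) ∧
      0 ≤ 4 * Certs.P2R0.Evaluator.s - Certs.P2R0.Evaluator.T * Certs.P2R0.Evaluator.lamT / ε :=
  Certs.P2R0.Evaluator.certificate 1 one_pos (by norm_num [Certs.P2R0.Evaluator.K_c])

/-! ## 2. The member `(3/2, 4, 1)`: constants of the tree's certificate as reals, cutoff, cover -/

/-- The certificate's `s` is `3/2` (EvalData `s`). -/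
theorem s_real : ((Certs.P2R0.Evaluator.s : ℚ) : ℝ) = 3 / 2 := by norm_num [Certs.P2R0.Evaluator.s]

/-- The certificate's `T = Σ|ĝ_p|` is `3` (EvalData `T`). -/
theorem T_real : ((Certs.P2R0.Evaluator.T : ℚ) : ℝ) = 3 := by norm_num [Certs.P2R0.Evaluator.T]

/-- The certificate's cutoff `K_c` is `7/2` (EvalData `K_c`). -/
theorem Kc_real : ((Certs.P2R0.Evaluator.K_c : ℚ) : ℝ) = 7 / 2 := by norm_num [Certs.P2R0.Evaluator.K_c]

/-- The member's coupling profile is the constant `g ≡ −(3/2·4/2)·1 = −3`, so `|g| ≤ 3 = T` on `[−1, 1]` (P2-PROOF 2.6: `T = Σ|ĝ_p| ≥ sup|g|`;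
here `P = 0`, `ĝ₀ = −3`). -/
theorem g_abs_le : ∀ x ∈ Set.Icc (-1 : ℝ) 1, |gOf (3 / 2) 4 (fun _ => 1) x| ≤ 3 := by
  intro x _
  simp only [gOf]
  rw [abs_le]
  constructor <;> norm_num

/-- The cutoff line over `ℝ` for the member, `3² ≤ (3/2 − 1)·(3/2)·(7/2)²`, TRANSPORTED from the tree's kernel-checked rational fact
`Certs.P2R0.Evaluator.cutoff : T ^ 2 ≤ (s - 1) * s * K_c ^ 2` (used by name; no restated copy of the certificate line). -/
theorem cutoff_real : (3 : ℝ) ^ 2 ≤ (3 / 2 - 1) * (3 / 2) * (7 / 2) ^ 2 := by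
  have h : ((Certs.P2R0.Evaluator.T : ℚ) : ℝ) ^ 2
      ≤ (((Certs.P2R0.Evaluator.s : ℚ) : ℝ) - 1) * ((Certs.P2R0.Evaluator.s : ℚ) : ℝ) * ((Certs.P2R0.Evaluator.K_c : ℚ) : ℝ) ^ 2 := by
    exact_mod_cast Certs.P2R0.Evaluator.cutoff
  rw [T_real, s_real, Kc_real] at h
  exact h

/-- **(★) for the member `(3/2, 4, 1)`** (P2-PROOF 2.8): the layer form is `≥ 0` on the one-sided class for EVERY `K > 0` — on `0 < K ≤ 7/2`
from the tree's finite certificate `Certs.P2R0.Evaluator.certificate` through the named `TailLemma`, on `K ≥ 7/2` from the proved cutoff. -/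
theorem layer_positivity (hT : TailLemma) : LayerPositivity (3 / 2) 4 (fun _ => 1) := by
  refine layerPositivity_of_cover (T := 3) (Kc := 7 / 2) (by norm_num) (by norm_num) g_abs_le cutoff_real ?_
  intro K hK hKc V Θ hVΘ
  have hKc' : K ≤ ((Certs.P2R0.Evaluator.K_c : ℚ) : ℝ) := by rw [Kc_real]; exact hKc
  obtain ⟨ε, hε, hM, hW, hT'⟩ := Certs.P2R0.Evaluator.certificate K hK hKc'
  exact hT K hK ε hε hM hW hT' V Θ hVΘ

/-- Admissibility of the member: `∫₀¹ η′ = 1` for `η′ ≡ 1` (also line `etap_integral` of `Certs.P2R0.Scalars`). -/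
theorem etap_integral : (∫ ζ in (0 : ℝ)..1, (fun _ : ℝ => (1 : ℝ)) ζ) = 1 := by simp

/-- The shape integral of the member: `I₂ = ∫₀¹ η′² = 1` for `η′ ≡ 1`. -/
theorem I2_eq : I2 (fun _ : ℝ => (1 : ℝ)) = 1 := by simp [I2]

/-! ## 3. The row theorem -/

/-- **ROW P2-R0 (CERTIFIED.md; P2-PROOF Theorem 1′, first rung).** For every quantity `Nu` obeying the background-method layer reduction
(`LayerReduction`, cited + refereed) and granted the Legendre tail lemma for the literal P2-R0 element rule (`TailLemma`, refereed):
`Nu(Ra) ≤ (3/16)·Ra^{1/2} − 1/2` for every `Ra ≥ 64`. Everything else — the finite certificate on the continuum `0 < K ≤ 7/2`, the cutoff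
`K ≥ 7/2`, the cover of all `K > 0` and the member arithmetic — is kernel-checked in the tree. (No-slip isothermal plates, every Pr, every
horizontal period, d = 2, 3, in the sense of `LayerReduction`'s docstring. For `Ra < 1707.76` the classical `Nu = 1` is sharper; this is the
soundness row, reproducing the by-hand member of Appendix A.7 (c)(iv).) -/
theorem nusselt_bound (Nu : ℝ → ℝ) (hRed : LayerReduction Nu) (hT : TailLemma) :
    ∀ Ra : ℝ, 64 ≤ Ra → Nu Ra ≤ 3 / 16 * Real.sqrt Ra - 1 / 2 := by
  intro Ra hRa
  have h := hRed (3 / 2) 4 (fun _ => 1) (by norm_num) (by norm_num) continuousOn_const etap_integral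
    (layer_positivity hT) Ra (le_trans (by norm_num) hRa)
  rw [I2_eq] at h
  linarith

/-- Vacuity guard (ii): `LayerReduction` is NOT provable for every `Nu` — granted `TailLemma`, the constant `Nu ≡ 2` violates it (the row bound
at `Ra = 64` is `3/16·8 − 1/2 = 1 < 2`). Together with `LayerForm.layerReduction_conduction` (`Nu ≡ 1` satisfies it): the hypothesis has content. -/
theorem layerReduction_nontrivial (hT : TailLemma) : ¬ LayerReduction (fun _ => 2) := by
  intro h
  have h64 := nusselt_bound (fun _ => 2) h hT 64 le_rfl
  have h8 : Real.sqrt 64 = 8 := by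
    rw [show (64 : ℝ) = 8 ^ 2 by norm_num, Real.sqrt_sq (by norm_num)]
  rw [h8] at h64
  norm_num at h64

end Summit.NavierStokesRegularity.TurbBounds.Results.P2R0

end
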